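import Literature.MathematicalPhysics.QuantumFieldTheory.Balaban1983to89.B9CubeLettersInvReadDict
import Literature.MathematicalPhysics.QuantumFieldTheory.Balaban1983to89.B9CoReadingCoordsS
import Literature.MathematicalPhysics.QuantumFieldTheory.Balaban1983to89.B9Thm33G0ProbeZeroAtPinsAdm

/-!
# `Balaban1983to89.B9Local342OfEBlockInv` — T. Bałaban, *Propagators for lattice gauge theories in a background field*, Commun. Math. Phys. **99** (1985) 389–434
# [Balaban1985BackgroundPropagators], Cor. 3.6 p. 408 + (3.42) p. 397 READ AT THE N06 CERTIFICATE'S COORDINATE MODELS: the four (3.42) entries of a site-sector letter `O(U)` over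
# the gauge-invariant test class (`EBlock (kernelFamilySInv i B cfg O par) B₀ δ U` — the currency of the tree's Cor-3.6 theorems for r05's sequence letter `G′_□`) give the four
# [4]-(2.51) block majorants of `GcoS … O U`, `DcoS ∘ GcoS`, `GcoS ∘ DscoS`, `LcoS ∘ GcoS` over the block map `blkSK (sIK bI)` — the shapes of `B9Thm37Whole.Local342.e0–e3`

[4] = T. Bałaban, *Propagators and renormalization transformations for lattice gauge theories. II*, Commun. Math. Phys. **96** (1984) 223–250 [`Balaban1984PropagatorsII`].
statement-level skeleton of published theorems with citation tags; proofs where landed; nothing here is a claim about the Yang–Mills mass gap.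

THE PRINT.  (3.42) p. 397 (*«|(G′(U)λ)(x)|, |(∇_UG′(U)λ)(x)|, |(G′(U)∇*_Uλ)(x)|, |(Δ_UG′(U)λ)(x)| ≦ B₀[(Lʲη)², Lʲη, Lʲη, 1]e^{−δ₀d(y,y′)}|λ| for x ∈ Δ(y), supp λ ⊂ Δ(y′)»*);
Cor. 3.6 p. 408 + p. 409 l. 1–5 (the same four inequalities for the cube letters `G′_□(U)` of the sequence `{Ω_n(□)}`); [4] (2.51) p. 232 (the block-majorant shape).

WHY THIS FILE (cell `pub-ymgap`, node N06 [B9], seat `pub-ymgap-dag-n06-c` g22; LOCATED-26 ∕ node00-def-Y WORD-79 road (a): rows 18's `h36 : Local342 (opsWalkY …)` becomes Cor. 3.6's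
conclusion once `opsWalkY.Gsq` is re-pinned to r05's sequence letter `GpCubeY`, for which the tree HAS Cor. 3.6 — `B9Cor36GpCoverBindersUnitary.eBlock_GpY_of_cubeData_unitary` — in the
currency `EBlock (kernelFamilySInv …)`; def-Y (6): «the `EBlock` ∕ `Local342` currencies — reading owed by whoever types the re-pin»).  THIS FILE is that reading, generic in the
letter `O`: lit-balaban's READ dictionary (`B9CubeLettersInvReadDict.sq_eta_mul_norm_le_of_eBlockInv` and its three siblings: the entries POINTWISE over the class
`TestY 𝔸 f`) applied to the re-assembled slices `Λ = assembleK b ν c F` of a block-supported coordinate vector `F` (test majorant `f = 𝟙_{Δ(βy′)}·b_b·|F|`), and the composites read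
through n06-d's `DcoS_comp_GcoS ∕ GcoS_comp_DscoS ∕ LcoS_comp_GcoS` (`= r • coordOpK b T`).  The target block must be a CARRIER block: `β (sIK bI z) = Δ(z)` for every site —
a section of `β` (`hβs`; at the members of record: the face's `hβI` on the section-carrying sub-family, `B9CoReadingCoordsS.sIK_faithful` + `B9BetaOntoOfBoxLevels`), exactly as
lit-balaban's own consumers assume (`ιB`, `hι`).  Constant `C = cR39 b·c_b·b_b·B₀`, SAME rate `δ`: ★★ `hasMajorant_GcoS_of_eBlockInv` (e0, profile `len²`), ★★
`hasMajorantHom_DcoS_GcoS_of_eBlockInv` (e1, `len`), ★★ `hasMajorantHom_GcoS_DscoS_of_eBlockInv` (e2, `len`), ★★ `hasMajorantHom_LcoS_GcoS_of_eBlockInv` (e3, `1`).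

HONEST SCOPE.  Dictionary algebra over landed readings; the (3.42) block is a HYPOTHESIS; nothing of [B9] asserted; COUNT-NEUTRAL; N06 NOT discharged; nothing continuum, nothing
about the mass gap ∕ Clay.  A NEW file; 0 `def`, no `sorry`, no `axiom`, no `instance`, no `notation`.
-/

noncomputable section

namespace Literature.MathematicalPhysics.QuantumFieldTheory.Balaban1983to89.B9Local342OfEBlockInv

open Node00 (SiteY FBondY IBondY CfgY SiteOpY SiteParY cdS cdsS lapS etaS)
open B6Geom246MultiLevelBox (blkOf)
open B6GlobalChartV1 (boxEquiv)
open B6Ineq2142KLevelV1 (β)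
open B6KLevelCensusIndexV1 (KIdx)
open B6RandomWalk (HasMajorant BlockSupp)
open B6RandomWalkHom (HasMajorantHom)
open B9Thm34Ext (toB6)
open B9FromB6 (EBlock)
open B9GeoNormsKLevelV1 (geo9K)
open B9Thm39ReadingCoords (cR39 cR39_nonneg coordBound39 basisBound39 abs_repr_le)
open B9CoReadingCoords (assembleK coordOpK coordOpK_apply)
open B9CoReadingCoordsS (XSK blkSK sIK GcoS DcoS DscoS LcoS DcoS_comp_GcoS GcoS_comp_DscoS LcoS_comp_GcoS lapSₗ lapSₗ_apply)
open B9CubeLettersInvReadings (TestY kernelFamilySInv)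
open B9CubeLettersInvReadDict (sq_eta_mul_norm_le_of_eBlockInv eta_mul_norm_cdS_le_of_eBlockInv eta_mul_norm_cdsS_le_of_eBlockInv norm_lapS_le_of_eBlockInv)
open B9Ineq349SiteComposite (cdSL cdsSL cdSL_apply cdsSL_apply etaS_pos)
open B9Thm33G0ProbeZeroAtPinsAdm (norm_assembleK_le)

variable {d ℓ : ℕ} {hd : 1 ≤ d + 1} {hL : Odd (ℓ + 1) ∧ 1 < ℓ + 1} {b₀ b₁ : ℝ}
variable {𝔸 : Type} [NormedRing 𝔸] [NormedAlgebra ℂ 𝔸] [CompleteSpace 𝔸] [FiniteDimensional ℝ 𝔸]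
variable {κ : Type} [Fintype κ]
variable (i : KIdx d ℓ hd hL b₀ b₁) [Fintype (geo9K i).Site] (b : Module.Basis κ ℝ 𝔸)
variable (B : B9.Backgrounds) (cfg : B.Cfg → CfgY 𝔸 i) (O : SiteOpY 𝔸 i) (par : SiteParY 𝔸 i)
variable {R₀ : ℝ} {H₀ : Prop} {bI : FBondY i → IBondY i} {B₀ δ : ℝ} {U₁ : B.Cfg}

/-! ## §1 The test-class packaging of a block-supported coordinate vector -/

omit [CompleteSpace 𝔸] [FiniteDimensional ℝ 𝔸] in
/-- ★ **A BLOCK-SUPPORTED COORDINATE VECTOR ASSEMBLES TO A MEMBER OF THE TEST CLASS**: if `F` is supported over `{q : blkSK (sIK bI) q = y′}` with `|F| ≤ Bd` there, and every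
site's index block is its carrier block (`β (sIK bI z) = Δ(z)`), then `Λ = assembleK b ν c F` satisfies `‖Λ(w)‖ ≤ f(w)` for the test majorant `f = 𝟙_{Δ(w) = β y′}·b_b·Bd`, which is
supported in `Δ(βy′)` with `|f| ≤ b_b·Bd`. [cite: Balaban1985BackgroundPropagators, (3.39) + (3.42) p.397 («|λ|», «supp λ ⊂ Δ(y′)»), bookkeeping] -/
theorem testY_of_blockSupp (hβs : ∀ z : SiteY i, β i.hN i.D i.hk (sIK i bI z) = blkOf i.D.toDomains z)
    {y' : IBondY i} {F : XSK κ i → ℝ} {Bd : ℝ} (hF : BlockSupp (g := toB6 (geo9K i) R₀ H₀) (blkSK i (sIK i bI)) F y' Bd) (ν : Fin (d + 1)) (c : κ) :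
    let f : SiteY i → ℝ := fun w => if blkOf i.D.toDomains w = β i.hN i.D i.hk y' then basisBound39 b * Bd else 0
    (∀ w, ‖assembleK b ν c F w‖ ≤ |f w|) ∧ (geo9K i).suppIn (Sum.inl f) y' ∧ (geo9K i).supNorm (Sum.inl f) ≤ basisBound39 b * Bd := by
  classical
  intro f
  have hbb : 0 ≤ basisBound39 b := Finset.sum_nonneg fun _ _ => norm_nonneg _
  have hBd : 0 ≤ basisBound39 b * Bd := mul_nonneg hbb hF.nonneg
  refine ⟨fun w => ?_, fun w hw => ?_, ?_⟩
  · by_cases hw : sIK i bI w = y'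
    · have hblk : blkOf i.D.toDomains w = β i.hN i.D i.hk y' := by rw [← hw]; exact (hβs w).symm
      have hf : f w = basisBound39 b * Bd := if_pos hblk
      rw [hf, abs_of_nonneg hBd]
      exact norm_assembleK_le b ν c F w fun a => hF.bound (w, ν, a, c) hw
    · have h0 : assembleK b ν c F w = 0 := by
        unfold assembleK
        exact Finset.sum_eq_zero fun a _ => by rw [hF.off (w, ν, a, c) hw, zero_smul]
      rw [h0, norm_zero]
      exact abs_nonneg _
  · by_contra hne
    exact hw (if_neg hne)
  · show (⨆ w, |f w|) ≤ basisBound39 b * Bd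
    refine Real.iSup_le (fun w => ?_) hBd
    by_cases h : blkOf i.D.toDomains w = β i.hN i.D i.hk y'
    · show |f w| ≤ _
      rw [show f w = basisBound39 b * Bd from if_pos h, abs_of_nonneg hBd]
    · show |f w| ≤ _
      rw [show f w = 0 from if_neg h, abs_zero]; exact hBd

/-! ## §2 The four block majorants -/

omit [CompleteSpace 𝔸] [FiniteDimensional ℝ 𝔸] [Fintype (geo9K i).Site] in
/-- the value of a scaled coordinate model at a carrier point. [cite: Balaban1985BackgroundPropagators, (3.42) p.397, dictionary] -/
theorem smul_coordOpK_apply (r : ℝ) (T : Fin (d + 1) → (SiteY i → 𝔸) →ₗ[ℝ] (SiteY i → 𝔸)) (F : XSK κ i → ℝ) (z : SiteY i) (ν : Fin (d + 1)) (a c : κ) :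
    (r • coordOpK b T) F (z, ν, a, c) = r * b.repr (T ν (assembleK b ν c F) z) a := by
  rw [LinearMap.smul_apply, Pi.smul_apply, smul_eq_mul, coordOpK_apply]

/-- ★★ **ENTRY 0: `HasMajorant (blkSK (sIK bI)) (GcoS … O U) (cR39·c_b·b_b·B₀·len²·e^{−δd})`** from the (3.42) block of `O(U)` over the class.
[cite: Balaban1985BackgroundPropagators, (3.42) p.397 (first member) + Cor. 3.6 p.408; Balaban1984PropagatorsII, (2.51) p.232] -/
theorem hasMajorant_GcoS_of_eBlockInv (hE : EBlock (kernelFamilySInv i B cfg O par) B₀ δ U₁) (hB₀ : 0 ≤ B₀)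
    (hβs : ∀ z : SiteY i, β i.hN i.D i.hk (sIK i bI z) = blkOf i.D.toDomains z) :
    HasMajorant (g := toB6 (geo9K i) R₀ H₀) (blkSK i (sIK i bI)) (GcoS i b B cfg O U₁)
      (fun a a' => cR39 b * coordBound39 b * basisBound39 b * B₀ * (geo9K i).len a ^ 2 * Real.exp (-(δ * (geo9K i).dist a a'))) := by
  classical
  have hcb : 0 ≤ coordBound39 b := by unfold coordBound39; exact norm_nonneg _
  intro y' F Bd hF q
  obtain ⟨z, ν, a, c⟩ := q
  obtain ⟨hΛ, hs, hsup⟩ := testY_of_blockSupp i b (R₀ := R₀) (H₀ := H₀) hβs hF ν c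
  set Λ : TestY 𝔸 (fun w => if blkOf i.D.toDomains w = β i.hN i.D i.hk y' then basisBound39 b * Bd else 0) := ⟨assembleK b ν c F, hΛ⟩ with hΛdef
  have hz : blkOf i.D.toDomains z = β i.hN i.D i.hk (sIK i bI z) := (hβs z).symm
  have hpt := sq_eta_mul_norm_le_of_eBlockInv i b cfg O par hE hcb (abs_repr_le b) _ (sIK i bI z) y' hs Λ hz
  show |(GcoS i b B cfg O U₁) F (z, ν, a, c)| ≤ _
  rw [GcoS, smul_coordOpK_apply]
  have hrep : |b.repr (O (cfg U₁) (assembleK b ν c F) z) a| ≤ coordBound39 b * ‖O (cfg U₁) (assembleK b ν c F) z‖ := abs_repr_le b _ a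
  have hη : 0 ≤ etaS i ^ 2 * cR39 b := mul_nonneg (sq_nonneg _) (cR39_nonneg b)
  rw [abs_mul, abs_of_nonneg hη]
  calc etaS i ^ 2 * cR39 b * |b.repr (O (cfg U₁) (assembleK b ν c F) z) a|
      ≤ etaS i ^ 2 * cR39 b * (coordBound39 b * ‖O (cfg U₁) (assembleK b ν c F) z‖) := mul_le_mul_of_nonneg_left hrep hη
    _ = cR39 b * coordBound39 b * (etaS i ^ 2 * ‖O (cfg U₁) (assembleK b ν c F) z‖) := by ring
    _ ≤ cR39 b * coordBound39 b * (B₀ * (geo9K i).len (sIK i bI z) ^ 2 * Real.exp (-(δ * (geo9K i).dist (sIK i bI z) y')) * (basisBound39 b * Bd)) :=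
        mul_le_mul_of_nonneg_left (hpt.trans (mul_le_mul_of_nonneg_left hsup (by positivity))) (mul_nonneg (cR39_nonneg b) hcb)
    _ = _ := by show _ = cR39 b * coordBound39 b * basisBound39 b * B₀ * (geo9K i).len (sIK i bI z) ^ 2 * Real.exp (-(δ * (geo9K i).dist (sIK i bI z) y')) * Bd; ring

/-- ★★ **ENTRY 1: `HasMajorantHom (blkSK (sIK bI)) (blkSK (sIK bI)) (DcoS U ∘ₗ GcoS O U) (cR39·c_b·b_b·B₀·len·e^{−δd})`**.
[cite: Balaban1985BackgroundPropagators, (3.42) p.397 (second member) + Cor. 3.6 p.408; Balaban1984PropagatorsII, (2.51) p.232] -/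
theorem hasMajorantHom_DcoS_GcoS_of_eBlockInv (hE : EBlock (kernelFamilySInv i B cfg O par) B₀ δ U₁) (hB₀ : 0 ≤ B₀)
    (hβs : ∀ z : SiteY i, β i.hN i.D i.hk (sIK i bI z) = blkOf i.D.toDomains z) :
    HasMajorantHom (g := toB6 (geo9K i) R₀ H₀) (blkSK i (sIK i bI)) (blkSK i (sIK i bI)) (DcoS i b B cfg U₁ ∘ₗ GcoS i b B cfg O U₁)
      (fun a a' => cR39 b * coordBound39 b * basisBound39 b * B₀ * (geo9K i).len a * Real.exp (-(δ * (geo9K i).dist a a'))) := by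
  classical
  have hcb : 0 ≤ coordBound39 b := by unfold coordBound39; exact norm_nonneg _
  intro y' F Bd hF q
  obtain ⟨z, ν, a, c⟩ := q
  obtain ⟨hΛ, hs, hsup⟩ := testY_of_blockSupp i b (R₀ := R₀) (H₀ := H₀) hβs hF ν c
  set Λ : TestY 𝔸 (fun w => if blkOf i.D.toDomains w = β i.hN i.D i.hk y' then basisBound39 b * Bd else 0) := ⟨assembleK b ν c F, hΛ⟩ with hΛdef
  have hz : blkOf i.D.toDomains z = β i.hN i.D i.hk (sIK i bI z) := (hβs z).symm
  have hpt := eta_mul_norm_cdS_le_of_eBlockInv i b cfg O par hE hcb (abs_repr_le b) _ (sIK i bI z) y' hs Λ ν hz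
  show |(DcoS i b B cfg U₁ ∘ₗ GcoS i b B cfg O U₁) F (z, ν, a, c)| ≤ _
  rw [DcoS_comp_GcoS, smul_coordOpK_apply, LinearMap.comp_apply, LinearMap.restrictScalars_apply, LinearMap.restrictScalars_apply, cdSL_apply]
  have hrep : |b.repr (cdS i (cfg U₁) ν (O (cfg U₁) (assembleK b ν c F)) z) a| ≤ coordBound39 b * ‖cdS i (cfg U₁) ν (O (cfg U₁) (assembleK b ν c F)) z‖ :=
    abs_repr_le b _ a
  have hη : 0 ≤ etaS i * cR39 b := mul_nonneg (etaS_pos i).le (cR39_nonneg b)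
  have hlen0 : 0 ≤ B₀ * (geo9K i).len (sIK i bI z) * Real.exp (-(δ * (geo9K i).dist (sIK i bI z) y')) :=
    mul_nonneg (mul_nonneg hB₀ (B9GeoLemma21KLevelV1.geo9K_len_pos i _).le) (Real.exp_nonneg _)
  rw [abs_mul, abs_of_nonneg hη]
  calc etaS i * cR39 b * |b.repr (cdS i (cfg U₁) ν (O (cfg U₁) (assembleK b ν c F)) z) a|
      ≤ etaS i * cR39 b * (coordBound39 b * ‖cdS i (cfg U₁) ν (O (cfg U₁) (assembleK b ν c F)) z‖) := mul_le_mul_of_nonneg_left hrep hη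
    _ = cR39 b * coordBound39 b * (etaS i * ‖cdS i (cfg U₁) ν (O (cfg U₁) (assembleK b ν c F)) z‖) := by ring
    _ ≤ cR39 b * coordBound39 b * (B₀ * (geo9K i).len (sIK i bI z) * Real.exp (-(δ * (geo9K i).dist (sIK i bI z) y')) * (basisBound39 b * Bd)) :=
        mul_le_mul_of_nonneg_left (hpt.trans (mul_le_mul_of_nonneg_left hsup hlen0)) (mul_nonneg (cR39_nonneg b) hcb)
    _ = _ := by show _ = cR39 b * coordBound39 b * basisBound39 b * B₀ * (geo9K i).len (sIK i bI z) * Real.exp (-(δ * (geo9K i).dist (sIK i bI z) y')) * Bd; ring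

/-- ★★ **ENTRY 2: `HasMajorantHom (blkSK (sIK bI)) (blkSK (sIK bI)) (GcoS O U ∘ₗ DscoS U) (cR39·c_b·b_b·B₀·len·e^{−δd})`**.
[cite: Balaban1985BackgroundPropagators, (3.42) p.397 (third member) + Cor. 3.6 p.408; Balaban1984PropagatorsII, (2.51) p.232] -/
theorem hasMajorantHom_GcoS_DscoS_of_eBlockInv (hE : EBlock (kernelFamilySInv i B cfg O par) B₀ δ U₁) (hB₀ : 0 ≤ B₀)
    (hβs : ∀ z : SiteY i, β i.hN i.D i.hk (sIK i bI z) = blkOf i.D.toDomains z) :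
    HasMajorantHom (g := toB6 (geo9K i) R₀ H₀) (blkSK i (sIK i bI)) (blkSK i (sIK i bI)) (GcoS i b B cfg O U₁ ∘ₗ DscoS i b B cfg U₁)
      (fun a a' => cR39 b * coordBound39 b * basisBound39 b * B₀ * (geo9K i).len a * Real.exp (-(δ * (geo9K i).dist a a'))) := by
  classical
  have hcb : 0 ≤ coordBound39 b := by unfold coordBound39; exact norm_nonneg _
  intro y' F Bd hF q
  obtain ⟨z, ν, a, c⟩ := q
  obtain ⟨hΛ, hs, hsup⟩ := testY_of_blockSupp i b (R₀ := R₀) (H₀ := H₀) hβs hF ν c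
  set Λ : TestY 𝔸 (fun w => if blkOf i.D.toDomains w = β i.hN i.D i.hk y' then basisBound39 b * Bd else 0) := ⟨assembleK b ν c F, hΛ⟩ with hΛdef
  have hz : blkOf i.D.toDomains z = β i.hN i.D i.hk (sIK i bI z) := (hβs z).symm
  have hpt := eta_mul_norm_cdsS_le_of_eBlockInv i b cfg O par hE hcb (abs_repr_le b) _ (sIK i bI z) y' hs Λ ν hz
  show |(GcoS i b B cfg O U₁ ∘ₗ DscoS i b B cfg U₁) F (z, ν, a, c)| ≤ _
  rw [GcoS_comp_DscoS, smul_coordOpK_apply, LinearMap.comp_apply, LinearMap.restrictScalars_apply, LinearMap.restrictScalars_apply, cdsSL_apply]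
  have hrep : |b.repr (O (cfg U₁) (cdsS i (cfg U₁) ν (assembleK b ν c F)) z) a| ≤ coordBound39 b * ‖O (cfg U₁) (cdsS i (cfg U₁) ν (assembleK b ν c F)) z‖ :=
    abs_repr_le b _ a
  have hη : 0 ≤ etaS i * cR39 b := mul_nonneg (etaS_pos i).le (cR39_nonneg b)
  have hlen0 : 0 ≤ B₀ * (geo9K i).len (sIK i bI z) * Real.exp (-(δ * (geo9K i).dist (sIK i bI z) y')) :=
    mul_nonneg (mul_nonneg hB₀ (B9GeoLemma21KLevelV1.geo9K_len_pos i _).le) (Real.exp_nonneg _)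
  rw [abs_mul, abs_of_nonneg hη]
  calc etaS i * cR39 b * |b.repr (O (cfg U₁) (cdsS i (cfg U₁) ν (assembleK b ν c F)) z) a|
      ≤ etaS i * cR39 b * (coordBound39 b * ‖O (cfg U₁) (cdsS i (cfg U₁) ν (assembleK b ν c F)) z‖) := mul_le_mul_of_nonneg_left hrep hη
    _ = cR39 b * coordBound39 b * (etaS i * ‖O (cfg U₁) (cdsS i (cfg U₁) ν (assembleK b ν c F)) z‖) := by ring
    _ ≤ cR39 b * coordBound39 b * (B₀ * (geo9K i).len (sIK i bI z) * Real.exp (-(δ * (geo9K i).dist (sIK i bI z) y')) * (basisBound39 b * Bd)) :=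
        mul_le_mul_of_nonneg_left (hpt.trans (mul_le_mul_of_nonneg_left hsup hlen0)) (mul_nonneg (cR39_nonneg b) hcb)
    _ = _ := by show _ = cR39 b * coordBound39 b * basisBound39 b * B₀ * (geo9K i).len (sIK i bI z) * Real.exp (-(δ * (geo9K i).dist (sIK i bI z) y')) * Bd; ring

/-- ★★ **ENTRY 3: `HasMajorantHom (blkSK (sIK bI)) (blkSK (sIK bI)) (LcoS U ∘ₗ GcoS O U) (cR39·c_b·b_b·B₀·e^{−δd})`**.
[cite: Balaban1985BackgroundPropagators, (3.42) p.397 (fourth member) + Cor. 3.6 p.408; Balaban1984PropagatorsII, (2.51) p.232] -/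
theorem hasMajorantHom_LcoS_GcoS_of_eBlockInv (hE : EBlock (kernelFamilySInv i B cfg O par) B₀ δ U₁) (hB₀ : 0 ≤ B₀)
    (hβs : ∀ z : SiteY i, β i.hN i.D i.hk (sIK i bI z) = blkOf i.D.toDomains z) :
    HasMajorantHom (g := toB6 (geo9K i) R₀ H₀) (blkSK i (sIK i bI)) (blkSK i (sIK i bI)) (LcoS i b B cfg U₁ ∘ₗ GcoS i b B cfg O U₁)
      (fun a a' => cR39 b * coordBound39 b * basisBound39 b * B₀ * Real.exp (-(δ * (geo9K i).dist a a'))) := by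
  classical
  have hcb : 0 ≤ coordBound39 b := by unfold coordBound39; exact norm_nonneg _
  intro y' F Bd hF q
  obtain ⟨z, ν, a, c⟩ := q
  obtain ⟨hΛ, hs, hsup⟩ := testY_of_blockSupp i b (R₀ := R₀) (H₀ := H₀) hβs hF ν c
  set Λ : TestY 𝔸 (fun w => if blkOf i.D.toDomains w = β i.hN i.D i.hk y' then basisBound39 b * Bd else 0) := ⟨assembleK b ν c F, hΛ⟩ with hΛdef
  have hz : blkOf i.D.toDomains z = β i.hN i.D i.hk (sIK i bI z) := (hβs z).symm
  have hpt := norm_lapS_le_of_eBlockInv i b cfg O par hE hcb (abs_repr_le b) _ (sIK i bI z) y' hs Λ hz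
  show |(LcoS i b B cfg U₁ ∘ₗ GcoS i b B cfg O U₁) F (z, ν, a, c)| ≤ _
  rw [LcoS_comp_GcoS, smul_coordOpK_apply, LinearMap.comp_apply, LinearMap.restrictScalars_apply, lapSₗ_apply]
  have hrep : |b.repr (lapS i (cfg U₁) (O (cfg U₁) (assembleK b ν c F)) z) a| ≤ coordBound39 b * ‖lapS i (cfg U₁) (O (cfg U₁) (assembleK b ν c F)) z‖ :=
    abs_repr_le b _ a
  rw [abs_mul, abs_of_nonneg (cR39_nonneg b)]
  calc cR39 b * |b.repr (lapS i (cfg U₁) (O (cfg U₁) (assembleK b ν c F)) z) a|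
      ≤ cR39 b * (coordBound39 b * ‖lapS i (cfg U₁) (O (cfg U₁) (assembleK b ν c F)) z‖) := mul_le_mul_of_nonneg_left hrep (cR39_nonneg b)
    _ ≤ cR39 b * (coordBound39 b * (B₀ * 1 * Real.exp (-(δ * (geo9K i).dist (sIK i bI z) y')) * (basisBound39 b * Bd))) :=
        mul_le_mul_of_nonneg_left (mul_le_mul_of_nonneg_left (hpt.trans (mul_le_mul_of_nonneg_left hsup (by positivity))) hcb) (cR39_nonneg b)
    _ = _ := by show _ = cR39 b * coordBound39 b * basisBound39 b * B₀ * Real.exp (-(δ * (geo9K i).dist (sIK i bI z) y')) * Bd; ring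

end Literature.MathematicalPhysics.QuantumFieldTheory.Balaban1983to89.B9Local342OfEBlockInv

end
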